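import Summits.QuantumAdvantage.AdviceFreeQNC0.CounterProcess
import HarnessLib

/-!
# Counter strategies III — RUNG R13 (window-free): `WalkHardFCounterSharp p`, PROVED for every `p` with `3 ∤ p`

Planner qa-qnc0-p2 g15, ROUND-15 (p2) §3.15 ADDENDUM 2 (statement VERBATIM from `line15/SketchR13.lean`; hand proof
there, every step numerically verified in `line15/entropy_check.py`).  **THEOREM** (`walkHardFCounterSharp`): for `3 ∤ p`,
EVERY strategy of α's u-walk game whose cut `g` reads the input only through the running weight `W_{<g} mod p`
(constant `𝔽_p`-degree `p − 1`, every cut reads every earlier bit — inside the dense residual, outside R7/R8/R9′/R11′)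
wins on at most `(2/3 + 2p·√(12p/(n+1)))·2ⁿ` inputs — the SHARP constant `2/3`.  Corollary: the rung
`WalkHardFCounter p` (`θ = 5/6`) for every prime `p ≠ 3` (`walkHardFCounter`).

PROOF (p2's six lines, in the `(g, a, b)`-model of `CounterLaws`/`CounterProcess`):
(1) `Q(law_{t+1}) = Q(law_t) − ¼‖ν₀ − ν₁‖₂²` (parallelogram; fires are bijections) ⇒ `Σ_t ‖ν₀−ν₁‖₂² = 4(Q₀ − Q_n) ≤
    4·4ⁿ(1 − 1/12p)` (`Q₀ = 4ⁿ` point mass, `Q_n ≥ 4ⁿ/12p` Cauchy–Schwarz) — `sum_D2_le`;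
(2) `‖ν₀ − ν₁‖₁² ≤ 12p·‖ν₀ − ν₁‖₂²` ⇒ some `t < n` has `‖ν₀−ν₁‖₁ ≤ 2·2ⁿ√(12p/(n+1))` (when `n + 1 > 12p`; else trivial);
(3) `λ̃ = ⅓(μ + Δ^p μ + Δ^{2p} μ)`, `‖μ − λ̃‖₁ ≤ p‖ν₀−ν₁‖₁` (`l1_lam_le`), fibres of `λ̃` constant in the label since `3 ∤ p`
    (`lam_const`); (4) `Φ(λ̃) ≥ 2ⁿ/3` (two-block lemma) and `Φ` is `ℓ¹`-Lipschitz ⇒ `Φ(μ_t⁺) ≥ 2ⁿ/3 − p‖ν₀−ν₁‖₁`;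
(5) `Φ` fire-invariant and bit-monotone ⇒ `Φ(μ_n⁺) ≥ Φ(μ_t⁺)` (`phi_lawP_mono`); (6) `#LOSE = μ_n⁺(L) ≥ Φ(μ_n⁺)`.
WHAT THIS IS NOT: windows (`WalkHardFPrefixCounter`) and non-adapted low-degree cuts (the dense crux) are NOT covered;
the rate is `n^{-1/2}`, not the true exponential; rung inside the dense residual; separation NOT moved.
-/

namespace Summit.QuantumAdvantage.AdviceFreeQNC0

open Finset

/-! ## §1 Statements (planner qa-qnc0-p2 g15 `line15/SketchR13.lean`, verbatim) -/

/-- the window-free sub-class (pure counters), the 12p-state chain: stated separately as the first target. -/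
def WalkHardFCounter (p : ℕ) [Fact p.Prime] : Prop :=
  ∃ θ : ℝ, θ < 1 ∧ ∃ n₀ : ℕ, ∀ n ≥ n₀, ∀ c : ℕ,
    ∀ y : Fin (n + 1) → (Fin n → Bool) → Bool,
      (∀ g : Fin (n + 1), ∀ u v : Fin n → Bool, wtPrefix u g.val % p = wtPrefix v g.val % p → y g u = y g v) →
        ((Finset.univ.filter fun u : Fin n → Bool => ringWinU c y u = true).card : ℝ) ≤ θ * (2 : ℝ) ^ n

/-- **`WalkHardFCounterSharp p`** — R13 window-free with the SHARP constant: for `3 ∤ p`, EVERY strategy whose cut `g`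
reads only `W_{<g} mod p` wins α's game on at most `(2/3 + 2p·√(12p/(n+1)))·2ⁿ` inputs. -/
def WalkHardFCounterSharp (p : ℕ) : Prop :=
  ¬ 3 ∣ p → 0 < p → ∀ n c : ℕ, ∀ y : Fin (n + 1) → (Fin n → Bool) → Bool,
    (∀ g : Fin (n + 1), ∀ u v : Fin n → Bool, wtPrefix u g.val % p = wtPrefix v g.val % p → y g u = y g v) →
      ((Finset.univ.filter fun u : Fin n → Bool => ringWinU c y u = true).card : ℝ)
        ≤ (2 / 3 + 2 * p * Real.sqrt (12 * p / (n + 1))) * (2 : ℝ) ^ n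

namespace CounterLaw

variable {n : ℕ} (p : ℕ) [NeZero p] (y : Fin (n + 1) → (Fin n → Bool) → Bool)

/-! ## §2 The `L²` budget -/

/-- `ℓ¹` displacement of a law under the last-bit involution `Δ = shK 1` (`= ‖ν₀ − ν₁‖₁`). -/
noncomputable def D1 (μ : St p → ℝ) : ℝ := l1 μ (fun x => μ ((shK p 1).symm x))

/-- squared `ℓ²` displacement under `Δ` (`= ‖ν₀ − ν₁‖₂²`). -/
noncomputable def D2 (μ : St p → ℝ) : ℝ := ∑ x, (μ x - μ ((shK p 1).symm x)) ^ 2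

/-- `D1 ≥ 0`. -/
theorem D1_nonneg (μ : St p → ℝ) : 0 ≤ D1 p μ := l1_nonneg _ _

/-- `D2 ≥ 0`. -/
theorem D2_nonneg (μ : St p → ℝ) : 0 ≤ D2 p μ := sum_nonneg fun _ _ => sq_nonneg _

/-- Cauchy–Schwarz: `D1² ≤ 12p·D2`. -/
theorem sq_D1_le (μ : St p → ℝ) : D1 p μ ^ 2 ≤ 12 * p * D2 p μ := by
  have h := sq_l1_le μ (fun x => μ ((shK p 1).symm x))
  rw [card_St] at h
  unfold D1 D2; push_cast at h; exact h

/-- fires preserve `Q`. -/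
theorem Q_lawP (t : ℕ) : Q (lawP p y t) = Q (law p y t) := by
  have h : lawP p y t = fun x => law p y t (Function.Involutive.toPerm (fireMap p y t) (fireMap_fireMap p y t) x) := by
    funext x; exact lawP_eq p y t x
  rw [h]; exact Q_comp_equiv _ _

omit [NeZero p] in
/-- the bit step as an average of two reindexed copies of `lawP t`. -/
theorem law_succ' (t : Fin n) (x : St p) :
    law p y (t.val + 1) x = (lawP p y t.val ((bitEq p false).symm x) + lawP p y t.val ((bitEq p true).symm x)) / 2 := by
  rw [law_succ, bitEq_symm_apply, bitEq_symm_apply]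
  simp only [Bool.toNat_false, Bool.toNat_true, add_zero, Nat.cast_one, Nat.cast_zero, sub_zero, Nat.reduceAdd,
    Nat.cast_ofNat]

/-- **(1) parallelogram**: `Q(law_{t+1}) = Q(lawP_t) − D2(lawP_t)/4`. -/
theorem Q_law_succ (t : Fin n) : Q (law p y (t.val + 1)) = Q (lawP p y t.val) - D2 p (lawP p y t.val) / 4 := by
  have h : law p y (t.val + 1) = fun x =>
      (lawP p y t.val ((bitEq p false).symm x) + lawP p y t.val ((bitEq p true).symm x)) / 2 := by
    funext x; exact law_succ' p y t x
  rw [h, Q_avg, Q_comp_equiv, Q_comp_equiv]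
  have hD : ∑ x, (lawP p y t.val ((bitEq p false).symm x) - lawP p y t.val ((bitEq p true).symm x)) ^ 2
      = D2 p (lawP p y t.val) := by
    unfold D2
    rw [← Equiv.sum_comp (bitEq p false)
      (fun x => (lawP p y t.val ((bitEq p false).symm x) - lawP p y t.val ((bitEq p true).symm x)) ^ 2)]
    refine sum_congr rfl fun x _ => ?_
    simp only [Equiv.symm_apply_apply, bitEq_true_symm_bitEq_false]
  rw [hD]; ring

/-- `Q(law_0) = (2ⁿ)²` (point mass). -/
theorem Q_law_zero : Q (law p y 0) = ((2 : ℝ) ^ n) ^ 2 := by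
  unfold Q
  simp only [law_zero]
  rw [Finset.sum_eq_single ((false, false), (0 : ZMod 3), (0 : ZMod p))]
  · simp
  · intro x _ hx; rw [if_neg hx]; ring
  · intro h; exact absurd (mem_univ _) h

/-- Cauchy–Schwarz: `(2ⁿ)² ≤ 12p·Q(law_t)`. -/
theorem sq_le_Q_law (t : ℕ) : ((2 : ℝ) ^ n) ^ 2 ≤ 12 * p * Q (law p y t) := by
  have h := sq_sum_le_card_mul_Q (law p y t)
  rw [sum_law, card_St] at h
  push_cast at h; exact h

/-- **the budget**: `Σ_{t<n} D2(lawP_t) ≤ 4·(2ⁿ)²·(1 − 1/12p)`. -/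
theorem sum_D2_le : ∑ t ∈ range n, D2 p (lawP p y t) ≤ 4 * ((2 : ℝ) ^ n) ^ 2 * (1 - 1 / (12 * p)) := by
  have htel : ∑ t ∈ range n, D2 p (lawP p y t) = 4 * (Q (law p y 0) - Q (law p y n)) := by
    rw [← Finset.sum_range_sub' (fun t => Q (law p y t)) n, mul_sum]
    refine sum_congr rfl fun t ht => ?_
    rw [mem_range] at ht
    have h := Q_law_succ p y ⟨t, ht⟩
    rw [Q_lawP] at h
    simp only at h
    linarith
  rw [htel, Q_law_zero]
  have hp : (0 : ℝ) < 12 * p := by have := NeZero.pos p; positivity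
  have h := sq_le_Q_law p y n
  have : ((2 : ℝ) ^ n) ^ 2 / (12 * p) ≤ Q (law p y n) := by rw [div_le_iff₀ hp]; linarith
  have e : 4 * ((2 : ℝ) ^ n) ^ 2 * (1 - 1 / (12 * p)) = 4 * ((2 : ℝ) ^ n) ^ 2 - 4 * (((2 : ℝ) ^ n) ^ 2 / (12 * p)) := by
    ring
  rw [e]; linarith

/-! ## §3 The averaged law `λ̃` -/

/-- `λ̃ = ⅓(μ + Δ^p μ + Δ^{2p} μ)`. -/
noncomputable def lam (μ : St p → ℝ) (x : St p) : ℝ :=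
  (μ x + μ ((shK p p).symm x) + μ ((shK p (2 * p)).symm x)) / 3

/-- `λ̃` has the same total mass. -/
theorem sum_lam (μ : St p → ℝ) : ∑ x, lam p μ x = ∑ x, μ x := by
  unfold lam
  rw [← sum_div, sum_add_distrib, sum_add_distrib, Equiv.sum_comp (shK p p).symm μ,
    Equiv.sum_comp (shK p (2 * p)).symm μ]
  ring

/-- **(3a)** `‖μ − λ̃‖₁ ≤ p·D1(μ)` (iterated shifts). -/
theorem l1_lam_le (μ : St p → ℝ) : l1 μ (lam p μ) ≤ p * D1 p μ := by
  have hk : ∀ k : ℕ, l1 μ (fun x => μ ((shK p k).symm x)) ≤ k * D1 p μ := by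
    intro k; rw [shK_eq_pow]; exact l1_iterate_le (shK p 1) μ k
  have h1 := hk p
  have h2 := hk (2 * p)
  have hsum : l1 μ (lam p μ) ≤ (l1 μ (fun x => μ ((shK p p).symm x)) + l1 μ (fun x => μ ((shK p (2 * p)).symm x))) / 3 := by
    unfold l1
    rw [← sum_add_distrib, sum_div]
    refine sum_le_sum fun x _ => ?_
    dsimp only
    unfold lam
    rw [le_div_iff₀ (by norm_num : (0 : ℝ) < 3)]
    have : |μ x - (μ x + μ ((shK p p).symm x) + μ ((shK p (2 * p)).symm x)) / 3| * 3
        = |(μ x - μ ((shK p p).symm x)) + (μ x - μ ((shK p (2 * p)).symm x))| := by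
      rw [← abs_of_pos (by norm_num : (0 : ℝ) < 3), ← abs_mul]; congr 1; ring
    rw [this]; exact abs_add_le _ _
  push_cast at h2
  linarith

omit [NeZero p] in
/-- `λ̃` is invariant under the label rotation by `p mod 3`. -/
theorem lam_shift (μ : St p → ℝ) (g : Bool × Bool) (a : ZMod 3) (b : ZMod p) :
    lam p μ (g, a - (p : ZMod 3), b) = lam p μ (g, a, b) := by
  unfold lam
  simp only [shK_symm_apply]
  have h3 : ((3 * p : ℕ) : ZMod 3) = 0 := by
    rw [ZMod.natCast_eq_zero_iff]; exact dvd_mul_right 3 p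
  have hp : ((p : ℕ) : ZMod p) = 0 := ZMod.natCast_self p
  have e1 : a - (p : ZMod 3) - ((2 * p : ℕ) : ZMod 3) = a := by
    rw [sub_sub, ← Nat.cast_add, show p + 2 * p = 3 * p by ring, h3, sub_zero]
  have e2 : b - ((2 * p : ℕ) : ZMod p) = b := by push_cast; rw [hp]; ring
  have e3 : b - ((p : ℕ) : ZMod p) = b := by rw [hp, sub_zero]
  have e4 : a - ((2 * p : ℕ) : ZMod 3) = a - (p : ZMod 3) - (p : ZMod 3) := by push_cast; ring
  simp only [e1, e2, e3, e4]
  ring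

omit [NeZero p] in
/-- **(3b)** for `3 ∤ p` the fibres of `λ̃` are constant in the label. -/
theorem lam_const (h3 : ¬ 3 ∣ p) (μ : St p → ℝ) (g : Bool × Bool) (a : ZMod 3) (b : ZMod p) :
    lam p μ (g, a, b) = lam p μ (g, 0, b) := by
  have hp : (p : ZMod 3) ≠ 0 := by rwa [Ne, ZMod.natCast_eq_zero_iff]
  have hs : ∀ a', lam p μ (g, a' - (p : ZMod 3), b) = lam p μ (g, a', b) := fun a' => lam_shift p μ g a' b
  -- `p mod 3 ∈ {1, 2}`; in both cases the shifts reach every label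
  have hcases : ∀ d : ZMod 3, d ≠ 0 → ∀ a' : ZMod 3, a' = 0 ∨ a' = 0 - d ∨ a' = 0 - d - d := by decide
  rcases hcases _ hp a with h | h | h
  · rw [h]
  · rw [h, hs]
  · rw [h, hs, hs]

/-! ## §4 `Φ` along the process -/

/-- **(4)** `Φ(lawP_t) ≥ 2ⁿ/3 − p·D1(lawP_t)`. -/
theorem phi_lawP_ge (h3 : ¬ 3 ∣ p) (t : ℕ) : (2 : ℝ) ^ n / 3 - p * D1 p (lawP p y t) ≤ phi (lawP p y t) := by
  have hthird : (2 : ℝ) ^ n / 3 ≤ phi (lam p (lawP p y t)) := by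
    rw [← sum_lawP p y t, ← sum_lam p]
    refine phi_ge_third _ (fun x => ?_) (fun g a b => lam_const p h3 _ g a b)
    have h0 := lawP_nonneg p y t
    exact div_nonneg (add_nonneg (add_nonneg (h0 _) (h0 _)) (h0 _)) (by norm_num)
  have hlip := abs_phi_sub_phi_le (lawP p y t) (lam p (lawP p y t))
  have hl := l1_lam_le p (lawP p y t)
  rw [abs_le] at hlip
  linarith [hlip.1]

/-- **(5)** `Φ` does not decrease along the process: `Φ(lawP_t) ≤ Φ(lawP_s)` for `t ≤ s ≤ n`. -/
theorem phi_lawP_mono {t s : ℕ} (hts : t ≤ s) (hs : s ≤ n) : phi (lawP p y t) ≤ phi (lawP p y s) := by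
  induction s, hts using Nat.le_induction with
  | base => exact le_rfl
  | succ s hts ih =>
    have hsn : s < n := hs
    refine (ih hsn.le).trans ?_
    -- bit step `lawP s → law (s+1)`, then fire step `law (s+1) → lawP (s+1)`
    have hbit : phi (lawP p y s) ≤ phi (law p y (s + 1)) := by
      have h := phi_bit_le (lawP p y s)
      have e : (fun x : St p => (lawP p y s (x.1, x.2.1 - 1, x.2.2) + lawP p y s (x.1, x.2.1 - 2, x.2.2 - 1)) / 2)
          = law p y (s + 1) := by
        funext x; exact (law_succ p y ⟨s, hsn⟩ x).symm
      rwa [e] at h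
    have hfire : phi (lawP p y (s + 1)) = phi (law p y (s + 1)) := by
      have e : lawP p y (s + 1) = fun x : St p =>
          law p y (s + 1) (if tabN p y (s + 1) x.2.2 then tog x.2.1 x.1 else x.1, x.2.1, x.2.2) := by
        funext x; exact lawP_eq p y (s + 1) x
      rw [e]; exact phi_fire (law p y (s + 1)) (tabN p y (s + 1))
    rw [hfire]; exact hbit

/-! ## §5 Assembly -/

/-- **(6) the LOSE count**: `#LOSE ≥ 2ⁿ/3 − p·D1(lawP_t)` for every `t ≤ n`. -/
theorem card_lose_ge (h3 : ¬ 3 ∣ p)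
    (hy : ∀ g : Fin (n + 1), ∀ u v : Fin n → Bool, wtPrefix u g.val % p = wtPrefix v g.val % p → y g u = y g v)
    (c : ℕ) {t : ℕ} (ht : t ≤ n) :
    (2 : ℝ) ^ n / 3 - p * D1 p (lawP p y t) ≤ ((univ.filter fun u : Fin n → Bool => ringWinU c y u = false).card : ℝ) := by
  rw [card_lose_eq p y hy c]
  exact ((phi_lawP_ge p y h3 t).trans (phi_lawP_mono p y ht le_rfl)).trans (phi_le_mass_sum _ _)

/-- **(2) a good time**: if `12p < n + 1` some `t < n` has `D1(lawP_t) ≤ 2·2ⁿ·√(12p/(n+1))`. -/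
theorem exists_D1_le (hn : 12 * p < n + 1) :
    ∃ t < n, D1 p (lawP p y t) ≤ 2 * (2 : ℝ) ^ n * Real.sqrt (12 * p / (n + 1)) := by
  have hn0 : 0 < n := by have := NeZero.pos p; omega
  have hne : (range n).Nonempty := ⟨0, mem_range.mpr hn0⟩
  set B : ℝ := 4 * ((2 : ℝ) ^ n) ^ 2 * (1 - 1 / (12 * p)) with hB
  obtain ⟨t, ht, hD2⟩ : ∃ t ∈ range n, D2 p (lawP p y t) ≤ B / n := by
    apply exists_le_of_sum_le hne
    rw [sum_const, card_range, nsmul_eq_mul]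
    have e : (n : ℝ) * (B / n) = B := by field_simp
    rw [e]; exact sum_D2_le p y
  refine ⟨t, mem_range.mp ht, ?_⟩
  have hp : (0 : ℝ) < p := by exact_mod_cast NeZero.pos p
  have hn' : (0 : ℝ) < n := by exact_mod_cast hn0
  have hn1 : (0 : ℝ) < n + 1 := by positivity
  set M : ℝ := (2 : ℝ) ^ n with hM
  have hMpos : 0 < M := by positivity
  -- D1² ≤ 12p·D2 ≤ 12p·B/n = 4M²(12p−1)/n ≤ 4M²·12p/(n+1)
  have h1 : D1 p (lawP p y t) ^ 2 ≤ 12 * p * (B / n) :=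
    (sq_D1_le p _).trans (mul_le_mul_of_nonneg_left hD2 (by positivity))
  have h2 : 12 * p * (B / n) ≤ (2 * M) ^ 2 * (12 * p / (n + 1)) := by
    rw [hB]
    have e : 12 * (p : ℝ) * (4 * M ^ 2 * (1 - 1 / (12 * p)) / n) = (2 * M) ^ 2 * ((12 * p - 1) / n) := by
      field_simp; ring
    rw [e]
    apply mul_le_mul_of_nonneg_left _ (by positivity)
    rw [div_le_div_iff₀ hn' hn1]
    have : (12 * p : ℝ) ≤ n + 1 := by exact_mod_cast hn.le
    nlinarith
  have h3' : D1 p (lawP p y t) ^ 2 ≤ (2 * M * Real.sqrt (12 * p / (n + 1))) ^ 2 := by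
    rw [mul_pow, Real.sq_sqrt (by positivity)]; exact h1.trans h2
  calc D1 p (lawP p y t) = Real.sqrt (D1 p (lawP p y t) ^ 2) := (Real.sqrt_sq (D1_nonneg p _)).symm
    _ ≤ Real.sqrt ((2 * M * Real.sqrt (12 * p / (n + 1))) ^ 2) := Real.sqrt_le_sqrt h3'
    _ = 2 * M * Real.sqrt (12 * p / (n + 1)) := Real.sqrt_sq (by positivity)

/-- **THE BOUND**: `#WIN ≤ (2/3 + 2p√(12p/(n+1)))·2ⁿ` for counter strategies, `3 ∤ p`. -/
theorem card_win_le (h3 : ¬ 3 ∣ p)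
    (hy : ∀ g : Fin (n + 1), ∀ u v : Fin n → Bool, wtPrefix u g.val % p = wtPrefix v g.val % p → y g u = y g v)
    (c : ℕ) :
    ((univ.filter fun u : Fin n → Bool => ringWinU c y u = true).card : ℝ)
      ≤ (2 / 3 + 2 * p * Real.sqrt (12 * p / (n + 1))) * (2 : ℝ) ^ n := by
  have hsplit : ((univ.filter fun u : Fin n → Bool => ringWinU c y u = true).card : ℝ)
      + ((univ.filter fun u : Fin n → Bool => ringWinU c y u = false).card : ℝ) = (2 : ℝ) ^ n := by
    have h := card_filter_add_card_filter_not (s := (univ : Finset (Fin n → Bool)))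
      (fun u : Fin n → Bool => ringWinU c y u = true)
    rw [card_univ, Fintype.card_fun, Fintype.card_bool, Fintype.card_fin] at h
    have e : (univ.filter fun u : Fin n → Bool => ¬ ringWinU c y u = true)
        = univ.filter fun u : Fin n → Bool => ringWinU c y u = false := by
      congr 1; ext u; simp
    rw [e] at h
    exact_mod_cast h
  have hp : (0 : ℝ) < p := by exact_mod_cast NeZero.pos p
  have hsq : 0 ≤ Real.sqrt (12 * p / (n + 1)) := Real.sqrt_nonneg _
  have hM : (0 : ℝ) < (2 : ℝ) ^ n := pow_pos (by norm_num) n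
  by_cases hn : 12 * p < n + 1
  · obtain ⟨t, ht, hD⟩ := exists_D1_le p y hn
    have hl := card_lose_ge p y h3 hy c ht.le
    have hpD : (p : ℝ) * D1 p (lawP p y t) ≤ p * (2 * (2 : ℝ) ^ n * Real.sqrt (12 * p / (n + 1))) :=
      mul_le_mul_of_nonneg_left hD hp.le
    linarith
  · -- trivial regime: `12p/(n+1) ≥ 1`
    have h1 : 1 ≤ Real.sqrt (12 * p / (n + 1)) := by
      rw [Real.one_le_sqrt, one_le_div (by positivity)]
      exact_mod_cast not_lt.mp hn
    have hlose : 0 ≤ ((univ.filter fun u : Fin n → Bool => ringWinU c y u = false).card : ℝ) := Nat.cast_nonneg _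
    have hp1 : (1 : ℝ) ≤ p := by exact_mod_cast NeZero.pos p
    have hps : (1 : ℝ) ≤ p * Real.sqrt (12 * p / (n + 1)) := by
      have := mul_le_mul hp1 h1 zero_le_one hp.le
      rwa [one_mul] at this
    have hco : (2 : ℝ) ^ n ≤ (2 / 3 + 2 * p * Real.sqrt (12 * p / (n + 1))) * (2 : ℝ) ^ n := by
      have : (1 : ℝ) ≤ 2 / 3 + 2 * p * Real.sqrt (12 * p / (n + 1)) := by linarith
      nlinarith
    linarith

end CounterLaw

/-! ## §6 The theorems -/

/-- **RUNG R13 (window-free), SHARP — PROVED for every `p` with `3 ∤ p`.** -/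
theorem walkHardFCounterSharp (p : ℕ) : WalkHardFCounterSharp p := by
  intro h3 hp n c y hy
  haveI : NeZero p := ⟨hp.ne'⟩
  exact CounterLaw.card_win_le p y h3 hy c

/-- the sharp bound gives the rung: `WalkHardFCounterSharp p → WalkHardFCounter p` (`θ := 5/6` once `n ≥ 1728 p³`;
planner's glue, verbatim). -/
theorem walkHardFCounter_of_sharp (p : ℕ) [hp : Fact p.Prime] (h3 : ¬ 3 ∣ p) (H : WalkHardFCounterSharp p) :
    WalkHardFCounter p := by
  refine ⟨5 / 6, by norm_num, 1728 * p ^ 3, fun n hn c y hy => ?_⟩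
  have hp0 : 0 < p := hp.out.pos
  have hmain := H h3 hp0 n c y hy
  have h2 : (0 : ℝ) ≤ (2 : ℝ) ^ n := by positivity
  refine hmain.trans (mul_le_mul_of_nonneg_right ?_ h2)
  have hp1 : (1 : ℝ) ≤ p := by exact_mod_cast hp0
  have hn' : (1728 : ℝ) * p ^ 3 ≤ n + 1 := by
    have : ((1728 * p ^ 3 : ℕ) : ℝ) ≤ n := by exact_mod_cast hn
    push_cast at this; linarith
  have hpos : (0 : ℝ) < n + 1 := by positivity
  have hfrac : (12 : ℝ) * p / (n + 1) ≤ (1 / (12 * p)) ^ 2 := by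
    rw [div_le_iff₀ hpos]
    have : (1 / (12 * (p : ℝ))) ^ 2 * (1728 * p ^ 3) = 12 * p := by
      field_simp; ring
    calc (12 : ℝ) * p = (1 / (12 * (p : ℝ))) ^ 2 * (1728 * p ^ 3) := this.symm
      _ ≤ (1 / (12 * (p : ℝ))) ^ 2 * (n + 1) := by
          apply mul_le_mul_of_nonneg_left hn'; positivity
  have hsq : Real.sqrt (12 * p / (n + 1)) ≤ 1 / (12 * p) := by
    calc Real.sqrt (12 * p / (n + 1)) ≤ Real.sqrt ((1 / (12 * p)) ^ 2) := Real.sqrt_le_sqrt hfrac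
      _ = 1 / (12 * p) := Real.sqrt_sq (by positivity)
  have : 2 * (p : ℝ) * Real.sqrt (12 * p / (n + 1)) ≤ 2 * p * (1 / (12 * p)) :=
    mul_le_mul_of_nonneg_left hsq (by positivity)
  have h16 : 2 * (p : ℝ) * (1 / (12 * p)) = 1 / 6 := by field_simp; ring
  linarith

/-- **RUNG R13 (window-free) — PROVED for every prime `p ≠ 3`**: counter strategies mod `p` win α's walk game on at
most `(5/6)·2ⁿ` inputs for `n ≥ 1728 p³`. -/
theorem walkHardFCounter (p : ℕ) [hp : Fact p.Prime] (hp3 : p ≠ 3) : WalkHardFCounter p :=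
  walkHardFCounter_of_sharp p
    (fun h => hp3 ((Nat.prime_dvd_prime_iff_eq Nat.prime_three hp.out).mp h).symm)
    (walkHardFCounterSharp p)

end Summit.QuantumAdvantage.AdviceFreeQNC0
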